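import Literature.AlgebraicGeometry.Motives.CurveSymmetricChart
import Literature.AlgebraicGeometry.Motives.CurveGeneralDivisorsNonempty
import Literature.NumberTheory.DiophantineGeometry.FunctionFieldDivisorClasses
import HarnessLib

/-!
# Points of `C^{(g)}` are determined by their divisors, and on `W` by their divisor classes
# (Milne, *Jacobian Varieties*, §3 Prop. 3.1, §5 proof of Thm. 5.1)

For a smooth projective geometrically integral curve `C / K`, field-valued points
`τ, τ' : Spec L → Cᵍ` over `K`:

* `exists_permOver_of_coordDivisorAt_eq` — if the coordinate divisors `Σᵢ τᵢ = Σᵢ τ'ᵢ` of the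
  function field of `C_L` agree then `τ' = σ · τ` for a permutation `σ` (equal sums of unit point
  masses differ by a permutation, `exists_perm_of_sum_single_eq`; places ↔ points,
  `place_injective`; rational points of `C_L` ↔ `L`-valued points, `ratPtPoint_injective`, from
  `FieldPoint.section_ext`), hence **`mk_imagePtPow_eq_of_coordDivisorAt_eq`**: the same image in
  `C^{(g)}` (`symPowProj.mk_eq_iff`) — the field-valued points of `C^{(g)}` "are" effective divisors;
* `eq_of_isLinearlyEquivalent_of_ell_eq_one` — effective `D ∼ D'` with `ℓ(D) = 1` are equal
  (`|D|` is a point), hence **`mk_imagePtPow_eq_of_isLinearlyEquivalent`**: on the general locus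
  (`ℓ(Σ τᵢ) = 1`) the divisor CLASS of `Σᵢ τᵢ` determines the point of `C^{(g)}` — Milne §5:
  "`f^{(r)} : C^{(r)}(k) → J(k)` is injective on `U'(k)`", the set-theoretic half of Thm. 5.1 (a)
  (`f^{(g)}|_W` is an open immersion), here for all field-valued points.

Everything is proved; no named facts (D-0026). Part of the construction of the Jacobian
(`nonempty_jacobian_of_isSmoothProjective`).

## References

* J. S. Milne, *Jacobian Varieties*, in: Arithmetic Geometry (Cornell–Silverman, eds.), Springer
  1986, §3 Prop. 3.1, Thm. 3.13; §5, proof of Thm. 5.1 (pp. 244–252 of the volume).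
  [Milne1986JacobianVarieties]
* H. Stichtenoth, *Algebraic Function Fields and Codes*, 2nd ed. (2009), §1.4. [Stichtenoth2009]
-/

noncomputable section

open CategoryTheory CategoryTheory.Limits AlgebraicGeometry IsLocalRing Order TopologicalSpace
  MonoidalCategory CartesianMonoidalCategory

universe u

/-! ### Function fields: a class with `ℓ = 1` contains at most one effective divisor -/

namespace Literature.NumberTheory.DiophantineGeometry.AlgFunctionField

variable {K : Type*} {F : Type*} [Field K] [Field F] [Algebra K F] [IsAlgFunctionField K F]

/-- **Effective linearly equivalent divisors `D ∼ D'` with `ℓ(D) = 1` are equal**: `D − D' = (x)`,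
so `x⁻¹ ∈ 𝓛(D) = K · 1`, `x` is a constant and `(x) = 0` (Stichtenoth §1.4; Milne §5: "the fibre of
`f^{(r)}` containing `D` can be identified with the linear system `|D|`", of dimension `ℓ(D) − 1 = 0`).
[cite: Milne1986JacobianVarieties, §5 (before Thm. 5.1)] -/
theorem eq_of_isLinearlyEquivalent_of_ell_eq_one {D D' : Divisor K F} (hD : 0 ≤ D) (hD' : 0 ≤ D')
    (hlin : D.IsLinearlyEquivalent D') (hell : ell D = 1) : D = D' := by
  obtain ⟨x, hx0, hx⟩ := hlin
  -- `x⁻¹ ∈ 𝓛(D)`: `(x⁻¹) + D = D' ≥ 0`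
  have hxinv : x⁻¹ ∈ riemannRochSpace D := by
    rw [mem_riemannRochSpace_iff_nonneg D (inv_ne_zero hx0), principalDivisor_inv hx0, hx]
    simpa using hD'
  have h1 : (1 : F) ∈ riemannRochSpace D := by
    have := algebraMap_mem_riemannRochSpace_zero (K := K) (F := F) 1
    rw [map_one] at this
    exact riemannRochSpace_mono hD this
  haveI := finiteDimensional_riemannRochSpace_of_isAlgFunctionField (K := K) D
  have hne : (⟨1, h1⟩ : riemannRochSpace D) ≠ 0 := fun h ↦ one_ne_zero (congrArg Subtype.val h)
  obtain ⟨c, hc⟩ := (finrank_eq_one_iff_of_nonzero' _ hne).1 hell ⟨x⁻¹, hxinv⟩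
  have hc' : algebraMap K F c = x⁻¹ := by
    have := congrArg Subtype.val hc
    simpa [Algebra.smul_def] using this
  have hc0 : c ≠ 0 := by
    rintro rfl
    rw [map_zero] at hc'
    exact inv_ne_zero hx0 hc'.symm
  have hprin : principalDivisor K x = 0 := by
    have h := principalDivisor_algebraMap (K := K) (F := F) hc0
    rw [hc', principalDivisor_inv hx0, neg_eq_zero] at h
    exact h
  rw [hprin] at hx
  exact (sub_eq_zero.1 hx.symm)

end Literature.NumberTheory.DiophantineGeometry.AlgFunctionField

namespace Literature.AlgebraicGeometry.Motives

open Literature.AlgebraicGeometry.RelativeSpec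

/-! ### Combinatorics: equal sums of unit point masses differ by a permutation -/

/-- If `Σᵢ [p i] = Σᵢ [p' i]` as finitely supported functions then `p' = p ∘ σ` for a permutation
`σ`. [folklore] -/
theorem exists_perm_of_sum_single_eq {α : Type*} [DecidableEq α] {g : ℕ} (p p' : Fin g → α)
    (h : ∑ i, Finsupp.single (p i) (1 : ℤ) = ∑ i, Finsupp.single (p' i) 1) :
    ∃ σ : Equiv.Perm (Fin g), ∀ i, p' i = p (σ i) := by
  classical
  -- equal fibre cardinalities
  have hcard : ∀ a, Fintype.card {i // p i = a} = Fintype.card {i // p' i = a} := by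
    intro a
    have ha := congrArg (fun f : α →₀ ℤ ↦ f a) h
    simp only [Finsupp.coe_finsetSum, Finset.sum_apply, Finsupp.single_apply] at ha
    rw [Finset.sum_boole, Finset.sum_boole] at ha
    have ha' : (Finset.univ.filter fun i ↦ p i = a).card = (Finset.univ.filter fun i ↦ p' i = a).card := by
      have := ha
      simp only [eq_comm (a := _)] at this
      exact_mod_cast ha
    rw [Fintype.card_subtype, Fintype.card_subtype]
    exact ha'
  let e : ∀ a, {i // p i = a} ≃ {i // p' i = a} := fun a ↦ Fintype.equivOfCardEq (hcard a)
  refine ⟨(Equiv.ofFiberEquiv e).symm, fun i ↦ ?_⟩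
  have := Equiv.ofFiberEquiv_map e ((Equiv.ofFiberEquiv e).symm i)
  rw [Equiv.apply_symm_apply] at this
  exact this

namespace CurvePlaces

open RatFn FieldPoint CartierDivisor Literature.NumberTheory.DiophantineGeometry
  Literature.NumberTheory.DiophantineGeometry.AlgFunctionField

variable {K : Type u} [Field K] (C : SchemeOver K) [IsIntegral C.left]
  [SmoothOfRelativeDimension 1 C.hom] [IsProper C.hom] [GeometricallyIntegral C.hom] (g : ℕ)
  {L : Type u} [Field L] (π : Spec (.of L) ⟶ Spec (.of K))

/-! ### Points of `Cᵍ` with the same divisor -/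

omit [IsIntegral C.left] [SmoothOfRelativeDimension 1 C.hom] [IsProper C.hom] [GeometricallyIntegral C.hom] in
/-- Distinct `L`-valued points of `C` give distinct rational points of `C_L`. [folklore] -/
theorem ratPtPoint_injective : Function.Injective fun Q : (Over.mk π ⟶ C) ↦ ratPtPoint C π Q := by
  intro Q₁ Q₂ h
  have h' : ratPt C π Q₁ = ratPt C π Q₂ :=
    section_ext (fieldPointStr C π) (ratPt_snd C π Q₁) (ratPt_snd C π Q₂) h
  ext : 1
  rw [← ratPt_fst C π Q₁, ← ratPt_fst C π Q₂, h']

omit [IsIntegral C.left] in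
/-- **Field-valued points of `Cᵍ` with the same coordinate divisor `Σᵢ τᵢ` differ by a permutation.**
[cite: Milne1986JacobianVarieties, §3 Prop. 3.1 and Thm. 3.13 (field-valued points)] -/
theorem exists_permOver_of_coordDivisorAt_eq (τ τ' : Over.mk π ⟶ powC C g)
    (h : coordDivisorAt C g π τ = coordDivisorAt C g π τ') :
    ∃ σ : Equiv.Perm (Fin g), τ' = τ ≫ permOver C.hom g σ := by
  classical
  obtain ⟨σ, hσ⟩ := exists_perm_of_sum_single_eq _ _ h
  refine ⟨σ.symm, hom_ext_projOver C.hom g _ _ fun i ↦ ?_⟩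
  rw [Category.assoc, permOver_projOver, Equiv.symm_symm]
  change τ' ≫ coord C g i = τ ≫ coord C g (σ i)
  have hi := place_injective (C := curveBC C π) _ _ (hσ i)
  exact ratPtPoint_injective C π hi

omit [IsIntegral C.left] in
/-- **Such points have the same image in `C^{(g)}`.** [cite: Milne1986JacobianVarieties, §3 Prop. 3.1] -/
theorem mk_imagePtPow_eq_of_coordDivisorAt_eq (hC : IsProjectiveOver C) (τ τ' : Over.mk π ⟶ powC C g)
    (h : coordDivisorAt C g π τ = coordDivisorAt C g π τ') :
    (symPowProj.mk C hC g).left (imagePtPow C g π τ) = (symPowProj.mk C hC g).left (imagePtPow C g π τ') := by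
  obtain ⟨σ, rfl⟩ := exists_permOver_of_coordDivisorAt_eq C g π τ τ' h
  rw [symPowProj.mk_eq_iff]
  refine ⟨σ, ?_⟩
  change (permOver C.hom g σ).left (τ.left (closedPoint L)) = (τ ≫ permOver C.hom g σ).left (closedPoint L)
  rw [Over.comp_left, Scheme.Hom.comp_apply]

/-! ### On the general locus the divisor CLASS determines the point -/

omit [IsIntegral C.left] in
/-- **On `W` the divisor class determines the point** (Milne §5: `f^{(g)}` is injective on `U'(k)`):
field-valued points `τ, τ'` of `Cᵍ` with linearly equivalent coordinate divisors and
`ℓ(Σ τᵢ) = 1` have the same image in `C^{(g)}`. [cite: Milne1986JacobianVarieties, §5 (proof of Thm. 5.1: "f^{(r)} is injective on U'(k)")] -/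
theorem mk_imagePtPow_eq_of_isLinearlyEquivalent (hC : IsProjectiveOver C) (τ τ' : Over.mk π ⟶ powC C g)
    (hlin : (coordDivisorAt C g π τ).IsLinearlyEquivalent (coordDivisorAt C g π τ'))
    (hell : ell (coordDivisorAt C g π τ) = 1) :
    (symPowProj.mk C hC g).left (imagePtPow C g π τ) = (symPowProj.mk C hC g).left (imagePtPow C g π τ') := by
  refine mk_imagePtPow_eq_of_coordDivisorAt_eq C g π hC τ τ' ?_
  refine eq_of_isLinearlyEquivalent_of_ell_eq_one ?_ ?_ hlin hell <;>
    exact Finset.sum_nonneg fun i _ ↦ Finsupp.single_nonneg.mpr zero_le_one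

end CurvePlaces

end Literature.AlgebraicGeometry.Motives
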